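import Mathlib

/-!
# Window bookkeeping for the shadow formula transfer
# (stub `stub_window` of line `Sketch`, crux `ShadowFormulaTransfer`)

Pure real-analysis bookkeeping of the composition of line `Sketch`. For a `0/1` `VP` family at
level `n` with degree `d ≥ 1`, padded size parameter `m`, circuit size `s` and `N` variables (all
`≤ (n+2)^c`), the depth-three chasm gives a `ΣΠΣ` circuit with `≤ 2^e` wires,
`e = K₁ ⌊√(d (log₂ m + 1)(log₂ s + 1))⌋ + K₁`, hence `T + 2, D + 2 ≤ 2^(e+2)` terms / factors. The
line's bet bounds `log₂` of the shadow's formula size by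
`(log₂ (T+2))^κ (log₂ (N+2))^K + K log₂ (D+2) + K` with `1 ≤ κ ≤ 2`; this file shows that this is
`≤ d^{κ/2} (log (n+2))^C + C` for `n ≥ n₀`, with `C := K + 3` depending only on `K` and every
family constant (`K₁`, `c`) absorbed into `n₀ := 3 ^ B`,
`B := 4 (K₁+2)² (2c+1)² ((2(c+2))^K + K)`.

Proof: `log₂ (T+2), log₂ (D+2) ≤ e + 2 =: E`, and `E² ≤ M d` with `M := 4 (K₁+2)² (a+1)²`,
`a := Nat.log 2 ((n+2)^c) ≤ 2 c log (n+2)`; then `x^κ = (x²)^{κ/2} ≤ (M d)^{κ/2} ≤ M d^{κ/2}` and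
`E = (E²)^{1/2} ≤ M d^{κ/2}`; `log₂ (N+2) ≤ 2 (c+2) log (n+2)`; finally
`M ((2(c+2))^K (log (n+2))^K + K) ≤ B (log (n+2))^{K+2} ≤ (log (n+2))^{K+3}` once `log (n+2) ≥ B`.
-/

set_option linter.dupNamespace false

noncomputable section

namespace Summit.ValiantsHypothesis.ValiantsHypothesis.Theorems.ShallowShadowsShadowFormulaTransfer

section Helpers

/-- If `E² ≤ M d` with `M, d ≥ 1`, then `E^μ ≤ M · d^{κ/2}` for `0 ≤ μ ≤ κ ≤ 2`
(`E^μ = (E²)^{μ/2} ≤ M^{μ/2} d^{μ/2}`, exponents `≤ 1` resp. `≤ κ/2` on bases `≥ 1`). [folklore] -/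
theorem window_rpow_le_of_sq_le {E M d μ κ : ℝ} (hE : 0 ≤ E) (hM : 1 ≤ M) (hd : 1 ≤ d)
    (h : E ^ 2 ≤ M * d) (hμ0 : 0 ≤ μ) (hμκ : μ ≤ κ) (hκ : κ ≤ 2) :
    E ^ μ ≤ M * d ^ (κ / 2) := by
  have h1 : E ^ μ = (E ^ 2) ^ (μ / 2) := by
    rw [← Real.rpow_two, ← Real.rpow_mul hE]
    congr 1
    ring
  rw [h1]
  calc (E ^ 2) ^ (μ / 2) ≤ (M * d) ^ (μ / 2) :=
        Real.rpow_le_rpow (by positivity) h (by linarith)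
    _ = M ^ (μ / 2) * d ^ (μ / 2) := Real.mul_rpow (by linarith) (by linarith)
    _ ≤ M ^ (1 : ℝ) * d ^ (κ / 2) :=
        mul_le_mul (Real.rpow_le_rpow_of_exponent_le hM (by linarith))
          (Real.rpow_le_rpow_of_exponent_le hd (by linarith))
          (Real.rpow_nonneg (by linarith) _) (Real.rpow_nonneg (by linarith) _)
    _ = M * d ^ (κ / 2) := by rw [Real.rpow_one]

/-- `log₂ x ≤ 2 log x` for `x ≥ 1` (as `log 2 > 1/2`). [folklore] -/
theorem window_logb_two_le_two_mul_log {x : ℝ} (hx : 1 ≤ x) :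
    Real.logb 2 x ≤ 2 * Real.log x := by
  have hlog2 : (1 : ℝ) / 2 < Real.log 2 := by
    have := Real.log_two_gt_d9
    norm_num at this ⊢
    linarith
  have hlx : 0 ≤ Real.log x := Real.log_nonneg hx
  rw [Real.logb, div_le_iff₀ (by linarith)]
  nlinarith [mul_nonneg hlx (by linarith : (0 : ℝ) ≤ 2 * Real.log 2 - 1)]

/-- `T + 2 ≤ 2^E` gives `log₂ (T + 2) ≤ E`. [folklore] -/
theorem window_logb_le_of_le_two_pow {T E : ℕ} (hT : T + 2 ≤ 2 ^ E) :
    Real.logb 2 ((T : ℝ) + 2) ≤ E := by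
  have h1 : (T : ℝ) + 2 ≤ (2 : ℝ) ^ E := by exact_mod_cast hT
  have h2 : Real.log ((T : ℝ) + 2) ≤ Real.log ((2 : ℝ) ^ E) :=
    Real.log_le_log (by positivity) h1
  rw [Real.log_pow] at h2
  have hlog2 : (0 : ℝ) < Real.log 2 := Real.log_pos (by norm_num)
  rw [Real.logb, div_le_iff₀ hlog2]
  exact h2

/-- `Nat.log 2 ((n+2)^c) ≤ 2 c log (n + 2)` (from `2 ^ Nat.log 2 x ≤ x` and `log 2 > 1/2`).
[folklore] -/
theorem window_natLog_pow_le (n c : ℕ) :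
    (Nat.log 2 ((n + 2) ^ c) : ℝ) ≤ 2 * c * Real.log ((n : ℝ) + 2) := by
  have h1 : 2 ^ Nat.log 2 ((n + 2) ^ c) ≤ (n + 2) ^ c :=
    Nat.pow_log_le_self 2 (pow_ne_zero _ (by omega))
  have h2 : (2 : ℝ) ^ Nat.log 2 ((n + 2) ^ c) ≤ ((n : ℝ) + 2) ^ c := by exact_mod_cast h1
  have h3 := Real.log_le_log (by positivity) h2
  rw [Real.log_pow, Real.log_pow] at h3
  have hlog2 : (1 : ℝ) / 2 < Real.log 2 := by
    have := Real.log_two_gt_d9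
    norm_num at this ⊢
    linarith
  have ha : (0 : ℝ) ≤ Nat.log 2 ((n + 2) ^ c) := Nat.cast_nonneg _
  nlinarith [mul_nonneg ha (by linarith : (0 : ℝ) ≤ 2 * Real.log 2 - 1)]

/-- `N ≤ (n+2)^c` gives `log₂ (N + 2) ≤ 2 (c + 2) log (n + 2)` (via `N + 2 ≤ (n+2)^(c+2)`).
[folklore] -/
theorem window_logb_le_of_le_pow {N n c : ℕ} (hN : N ≤ (n + 2) ^ c) :
    Real.logb 2 ((N : ℝ) + 2) ≤ 2 * (c + 2) * Real.log ((n : ℝ) + 2) := by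
  have hn0 : (0 : ℝ) ≤ n := Nat.cast_nonneg n
  have hN0 : (0 : ℝ) ≤ N := Nat.cast_nonneg N
  have hp : (1 : ℝ) ≤ ((n : ℝ) + 2) ^ c := one_le_pow₀ (by linarith)
  have hNr : (N : ℝ) ≤ ((n : ℝ) + 2) ^ c := by exact_mod_cast hN
  have h4 : ((n : ℝ) + 2) ^ c * 4 ≤ ((n : ℝ) + 2) ^ c * ((n : ℝ) + 2) ^ 2 :=
    mul_le_mul_of_nonneg_left (by nlinarith [sq_nonneg (n : ℝ), hn0]) (by linarith)
  have hN2 : (N : ℝ) + 2 ≤ ((n : ℝ) + 2) ^ (c + 2) := by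
    rw [pow_add]
    linarith
  have h1 : Real.log ((N : ℝ) + 2) ≤ Real.log (((n : ℝ) + 2) ^ (c + 2)) :=
    Real.log_le_log (by positivity) hN2
  rw [Real.log_pow] at h1
  push_cast at h1
  have h2 := window_logb_two_le_two_mul_log (x := (N : ℝ) + 2) (by linarith)
  calc Real.logb 2 ((N : ℝ) + 2) ≤ 2 * Real.log ((N : ℝ) + 2) := h2
    _ ≤ 2 * ((c + 2) * Real.log ((n : ℝ) + 2)) := by linarith
    _ = 2 * (c + 2) * Real.log ((n : ℝ) + 2) := by ring

/-- The exponent bound: `(K₁ q + K₁ + 2)² ≤ 4 (K₁ + 2)² P² · d` when `q² ≤ d P²` and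
`d, P ≥ 1`. [folklore] -/
theorem window_sq_exponent_le {K₁ q d P : ℝ} (hq : 0 ≤ q) (hK : 0 ≤ K₁) (hd : 1 ≤ d)
    (hP : 1 ≤ P) (hq2 : q ^ 2 ≤ d * P ^ 2) :
    (K₁ * q + K₁ + 2) ^ 2 ≤ 4 * (K₁ + 2) ^ 2 * P ^ 2 * d := by
  have h1 : K₁ * q + K₁ + 2 ≤ (K₁ + 2) * (q + 1) := by nlinarith
  have h2 : (K₁ * q + K₁ + 2) ^ 2 ≤ ((K₁ + 2) * (q + 1)) ^ 2 :=
    pow_le_pow_left₀ (by positivity) h1 2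
  have hP2 : 1 ≤ P ^ 2 := one_le_pow₀ hP
  have hdP : 1 ≤ d * P ^ 2 := by nlinarith
  have h3 : (q + 1) ^ 2 ≤ 4 * (d * P ^ 2) := by nlinarith [sq_nonneg (q - 1)]
  calc (K₁ * q + K₁ + 2) ^ 2 ≤ ((K₁ + 2) * (q + 1)) ^ 2 := h2
    _ = (K₁ + 2) ^ 2 * (q + 1) ^ 2 := by ring
    _ ≤ (K₁ + 2) ^ 2 * (4 * (d * P ^ 2)) := mul_le_mul_of_nonneg_left h3 (by positivity)
    _ = 4 * (K₁ + 2) ^ 2 * P ^ 2 * d := by ring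

/-- For `3 ^ B ≤ n`: `B ≤ log (n + 2)` and `1 ≤ log (n + 2)` (as `log 3 ≥ 1`). [folklore] -/
theorem window_log_lower {B n : ℕ} (hn : 3 ^ B ≤ n) :
    (B : ℝ) ≤ Real.log ((n : ℝ) + 2) ∧ 1 ≤ Real.log ((n : ℝ) + 2) := by
  have hlog3 : (1 : ℝ) ≤ Real.log 3 := by
    have h : Real.log (Real.exp 1) ≤ Real.log 3 :=
      Real.log_le_log (Real.exp_pos 1) (le_of_lt (lt_trans Real.exp_one_lt_d9 (by norm_num)))
    rwa [Real.log_exp] at h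
  have hn3 : (3 : ℝ) ^ B ≤ (n : ℝ) := by exact_mod_cast hn
  have h3B : (1 : ℝ) ≤ (3 : ℝ) ^ B := one_le_pow₀ (by norm_num)
  have h1 : Real.log ((3 : ℝ) ^ B) ≤ Real.log ((n : ℝ) + 2) :=
    Real.log_le_log (by positivity) (by linarith)
  rw [Real.log_pow] at h1
  have h2 : Real.log 3 ≤ Real.log ((n : ℝ) + 2) :=
    Real.log_le_log (by norm_num) (by linarith)
  have hB0 : (0 : ℝ) ≤ B := Nat.cast_nonneg B
  constructor
  · linarith [mul_le_mul_of_nonneg_left hlog3 hB0]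
  · linarith

end Helpers

/-- Stub Window (real bookkeeping of line `Sketch`): with `1 ≤ κ ≤ 2`, the bet's bound
`(log₂ (T+2))^κ (log₂ (N+2))^K + K log₂ (D+2) + K`, for `T + 2, D + 2 ≤ 2^(e+2)`,
`e = K₁ ⌊√(d (log₂ m + 1)(log₂ s + 1))⌋ + K₁`, `m, s, N ≤ (n+2)^c`, `d ≥ 1`, is
`≤ d^{κ/2} (log (n+2))^C + C` for `n ≥ n₀`, with `C := K + 3` (depending only on `K`) and
`n₀ := 3 ^ (4 (K₁+2)² (2c+1)² ((2(c+2))^K + K))`. [folklore] -/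
theorem stub_window :
    ∀ (κ : ℝ) (K : ℕ), 1 ≤ κ → κ ≤ 2 → ∃ C : ℕ, ∀ (K₁ c : ℕ), ∃ n₀ : ℕ,
      ∀ (n d m s N T D : ℕ), n₀ ≤ n → 1 ≤ d → m ≤ (n + 2) ^ c → s ≤ (n + 2) ^ c →
        N ≤ (n + 2) ^ c →
        T + 2 ≤ 2 ^ (K₁ * Nat.sqrt (d * (Nat.log 2 m + 1) * (Nat.log 2 s + 1)) + K₁ + 2) →
        D + 2 ≤ 2 ^ (K₁ * Nat.sqrt (d * (Nat.log 2 m + 1) * (Nat.log 2 s + 1)) + K₁ + 2) →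
        Real.logb 2 (T + 2) ^ κ * Real.logb 2 (N + 2) ^ K + K * Real.logb 2 (D + 2) + K ≤
          (d : ℝ) ^ (κ / 2) * Real.log (n + 2) ^ C + C := by
  intro κ K hκ1 hκ2
  refine ⟨K + 3, fun K₁ c =>
    ⟨3 ^ (4 * (K₁ + 2) ^ 2 * (2 * c + 1) ^ 2 * ((2 * (c + 2)) ^ K + K)), ?_⟩⟩
  intro n d m s N T D hn hd hm hs hN hT hD
  obtain ⟨hℓB, hℓ1⟩ := window_log_lower hn
  push_cast at hℓB
  set ℓ : ℝ := Real.log ((n : ℝ) + 2) with hℓdef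
  have hℓ0 : 0 < ℓ := by linarith
  -- natural-number bookkeeping: `q² ≤ d (a+1)²`
  set q : ℕ := Nat.sqrt (d * (Nat.log 2 m + 1) * (Nat.log 2 s + 1)) with hqdef
  set a : ℕ := Nat.log 2 ((n + 2) ^ c) with hadef
  have hLm : Nat.log 2 m + 1 ≤ a + 1 := Nat.succ_le_succ (Nat.log_mono_right hm)
  have hLs : Nat.log 2 s + 1 ≤ a + 1 := Nat.succ_le_succ (Nat.log_mono_right hs)
  have hX : d * (Nat.log 2 m + 1) * (Nat.log 2 s + 1) ≤ d * (a + 1) * (a + 1) :=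
    Nat.mul_le_mul (Nat.mul_le_mul le_rfl hLm) hLs
  have hq2 : q * q ≤ d * (a + 1) * (a + 1) := le_trans (Nat.sqrt_le _) hX
  have hq2r : (q : ℝ) ^ 2 ≤ (d : ℝ) * ((a : ℝ) + 1) ^ 2 := by
    have h : ((q * q : ℕ) : ℝ) ≤ ((d * (a + 1) * (a + 1) : ℕ) : ℝ) := by exact_mod_cast hq2
    push_cast at h
    linarith only [h]
  have hdr : (1 : ℝ) ≤ d := by exact_mod_cast hd
  have ha0 : (0 : ℝ) ≤ a := Nat.cast_nonneg a
  have ha1 : (1 : ℝ) ≤ (a : ℝ) + 1 := by linarith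
  have hK₁0 : (0 : ℝ) ≤ K₁ := Nat.cast_nonneg K₁
  have hK0 : (0 : ℝ) ≤ K := Nat.cast_nonneg K
  -- the exponent `E := K₁ q + K₁ + 2` has `E² ≤ M d`
  have hE2 : ((K₁ : ℝ) * q + K₁ + 2) ^ 2 ≤ 4 * ((K₁ : ℝ) + 2) ^ 2 * ((a : ℝ) + 1) ^ 2 * d :=
    window_sq_exponent_le (Nat.cast_nonneg q) hK₁0 hdr ha1 hq2r
  obtain ⟨M, hMdef⟩ : ∃ M : ℝ, M = 4 * ((K₁ : ℝ) + 2) ^ 2 * ((a : ℝ) + 1) ^ 2 := ⟨_, rfl⟩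
  have hE2' : ((K₁ : ℝ) * q + K₁ + 2) ^ 2 ≤ M * d := by rw [hMdef]; exact hE2
  have hM1 : (1 : ℝ) ≤ M := by
    have h1 : (1 : ℝ) ≤ ((K₁ : ℝ) + 2) ^ 2 := one_le_pow₀ (by linarith only [hK₁0])
    have h2 : (1 : ℝ) ≤ ((a : ℝ) + 1) ^ 2 := one_le_pow₀ ha1
    have h12 := one_le_mul_of_one_le_of_one_le h1 h2
    rw [hMdef]
    linarith only [h12]
  have hM0 : (0 : ℝ) ≤ M := by linarith
  -- the three logarithms
  have hx : Real.logb 2 ((T : ℝ) + 2) ≤ (K₁ : ℝ) * q + K₁ + 2 := by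
    have h := window_logb_le_of_le_two_pow hT
    push_cast at h
    exact h
  have hx0 : 0 ≤ Real.logb 2 ((T : ℝ) + 2) :=
    Real.logb_nonneg (by norm_num) (by linarith [(Nat.cast_nonneg T : (0 : ℝ) ≤ T)])
  have hz : Real.logb 2 ((D : ℝ) + 2) ≤ (K₁ : ℝ) * q + K₁ + 2 := by
    have h := window_logb_le_of_le_two_pow hD
    push_cast at h
    exact h
  have hy : Real.logb 2 ((N : ℝ) + 2) ≤ 2 * (c + 2) * ℓ := window_logb_le_of_le_pow hN
  have hy0 : 0 ≤ Real.logb 2 ((N : ℝ) + 2) :=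
    Real.logb_nonneg (by norm_num) (by linarith [(Nat.cast_nonneg N : (0 : ℝ) ≤ N)])
  have hdκ : (0 : ℝ) ≤ (d : ℝ) ^ (κ / 2) := Real.rpow_nonneg (by linarith) _
  -- `x ^ κ ≤ M d^{κ/2}`
  have hxκ : Real.logb 2 ((T : ℝ) + 2) ^ κ ≤ M * (d : ℝ) ^ (κ / 2) := by
    refine window_rpow_le_of_sq_le hx0 hM1 hdr ?_ (by linarith) le_rfl hκ2
    calc Real.logb 2 ((T : ℝ) + 2) ^ 2 ≤ ((K₁ : ℝ) * q + K₁ + 2) ^ 2 :=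
          pow_le_pow_left₀ hx0 hx 2
      _ ≤ M * d := hE2'
  -- `z ≤ E ≤ M d^{κ/2}`
  have hzM : Real.logb 2 ((D : ℝ) + 2) ≤ M * (d : ℝ) ^ (κ / 2) := by
    have hE0 : (0 : ℝ) ≤ (K₁ : ℝ) * q + K₁ + 2 := by positivity
    have h := window_rpow_le_of_sq_le hE0 hM1 hdr hE2' zero_le_one hκ1 hκ2
    rw [Real.rpow_one] at h
    exact le_trans hz h
  -- `y ^ K ≤ (2(c+2))^K ℓ^K`
  have hyK : Real.logb 2 ((N : ℝ) + 2) ^ K ≤ (2 * ((c : ℝ) + 2)) ^ K * ℓ ^ K := by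
    rw [← mul_pow]
    exact pow_le_pow_left₀ hy0 hy K
  -- `M ≤ 4 (K₁+2)² (2c+1)² ℓ²`
  have ha : (a : ℝ) ≤ 2 * c * ℓ := window_natLog_pow_le n c
  have hP : (a : ℝ) + 1 ≤ (2 * c + 1) * ℓ := by linarith only [ha, hℓ1]
  have hMA : M ≤ 4 * ((K₁ : ℝ) + 2) ^ 2 * (2 * c + 1) ^ 2 * ℓ ^ 2 := by
    have h : ((a : ℝ) + 1) ^ 2 ≤ ((2 * c + 1) * ℓ) ^ 2 := pow_le_pow_left₀ (by linarith) hP 2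
    rw [hMdef]
    calc 4 * ((K₁ : ℝ) + 2) ^ 2 * ((a : ℝ) + 1) ^ 2
        ≤ 4 * ((K₁ : ℝ) + 2) ^ 2 * ((2 * c + 1) * ℓ) ^ 2 :=
          mul_le_mul_of_nonneg_left h (by positivity)
      _ = 4 * ((K₁ : ℝ) + 2) ^ 2 * (2 * c + 1) ^ 2 * ℓ ^ 2 := by ring
  -- assemble
  have hℓK : (1 : ℝ) ≤ ℓ ^ K := one_le_pow₀ hℓ1
  have step1 : Real.logb 2 ((T : ℝ) + 2) ^ κ * Real.logb 2 ((N : ℝ) + 2) ^ K ≤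
      (M * (d : ℝ) ^ (κ / 2)) * ((2 * ((c : ℝ) + 2)) ^ K * ℓ ^ K) :=
    mul_le_mul hxκ hyK (pow_nonneg hy0 K) (mul_nonneg hM0 hdκ)
  have step2 : (K : ℝ) * Real.logb 2 ((D : ℝ) + 2) ≤ (K : ℝ) * (M * (d : ℝ) ^ (κ / 2)) :=
    mul_le_mul_of_nonneg_left hzM hK0
  have step3 : M * ((2 * ((c : ℝ) + 2)) ^ K * ℓ ^ K + K) ≤ ℓ ^ (K + 3) := by
    have hc0 : (0 : ℝ) ≤ c := Nat.cast_nonneg c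
    have h1 : M * ((2 * ((c : ℝ) + 2)) ^ K * ℓ ^ K + K) ≤
        (4 * ((K₁ : ℝ) + 2) ^ 2 * (2 * c + 1) ^ 2 * ℓ ^ 2) *
          ((2 * ((c : ℝ) + 2)) ^ K * ℓ ^ K + K * ℓ ^ K) := by
      refine mul_le_mul hMA ?_ (by positivity) (by positivity)
      linarith only [mul_le_mul_of_nonneg_left hℓK hK0]
    have h2 : (4 * ((K₁ : ℝ) + 2) ^ 2 * (2 * c + 1) ^ 2 * ℓ ^ 2) *
          ((2 * ((c : ℝ) + 2)) ^ K * ℓ ^ K + K * ℓ ^ K) =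
        (4 * ((K₁ : ℝ) + 2) ^ 2 * (2 * c + 1) ^ 2 * ((2 * ((c : ℝ) + 2)) ^ K + K)) *
          ℓ ^ (K + 2) := by ring
    have h3 : 4 * ((K₁ : ℝ) + 2) ^ 2 * (2 * c + 1) ^ 2 * ((2 * ((c : ℝ) + 2)) ^ K + K) ≤ ℓ :=
      hℓB
    have hℓK2 : (0 : ℝ) ≤ ℓ ^ (K + 2) := by positivity
    calc M * ((2 * ((c : ℝ) + 2)) ^ K * ℓ ^ K + K)
        ≤ (4 * ((K₁ : ℝ) + 2) ^ 2 * (2 * c + 1) ^ 2 * ((2 * ((c : ℝ) + 2)) ^ K + K)) *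
            ℓ ^ (K + 2) := by rw [← h2]; exact h1
      _ ≤ ℓ * ℓ ^ (K + 2) := mul_le_mul_of_nonneg_right h3 hℓK2
      _ = ℓ ^ (K + 3) := by ring
  have final : Real.logb 2 ((T : ℝ) + 2) ^ κ * Real.logb 2 ((N : ℝ) + 2) ^ K +
        (K : ℝ) * Real.logb 2 ((D : ℝ) + 2) + K ≤
      (d : ℝ) ^ (κ / 2) * ℓ ^ (K + 3) + ((K : ℝ) + 3) := by
    have h4 := mul_le_mul_of_nonneg_left step3 hdκ
    calc Real.logb 2 ((T : ℝ) + 2) ^ κ * Real.logb 2 ((N : ℝ) + 2) ^ K +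
          (K : ℝ) * Real.logb 2 ((D : ℝ) + 2) + K
        ≤ (M * (d : ℝ) ^ (κ / 2)) * ((2 * ((c : ℝ) + 2)) ^ K * ℓ ^ K) +
            (K : ℝ) * (M * (d : ℝ) ^ (κ / 2)) + K := by linarith only [step1, step2]
      _ = (d : ℝ) ^ (κ / 2) * (M * ((2 * ((c : ℝ) + 2)) ^ K * ℓ ^ K + K)) + K := by ring
      _ ≤ (d : ℝ) ^ (κ / 2) * ℓ ^ (K + 3) + K := by linarith only [h4]
      _ ≤ (d : ℝ) ^ (κ / 2) * ℓ ^ (K + 3) + ((K : ℝ) + 3) := by linarith only [hK0]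
  have hK3 : ((K + 3 : ℕ) : ℝ) = (K : ℝ) + 3 := by push_cast; ring
  rw [hK3]
  exact final

end Summit.ValiantsHypothesis.ValiantsHypothesis.Theorems.ShallowShadowsShadowFormulaTransfer

end
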